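import Summits.QuantumFields.BalabanUV.Beta.D1BFx.PeriodicArrayWrapUniform

/-!
# `BalabanUV.Beta.D1BFx.PeriodicArrayWrapColH` — road «BF-x» for binder row D1, slot (K), chain step (I) «(A1)-PACKED», brick «WRAP-LIMIT», part 3
# «WRAP-AT-THE-ROAD'S-WEIGHTS»: the two WRAP sockets — the `s`-UNIFORM bi-localisation («WRAP-UNIFORM») and the ENTRYWISE limit («WRAP-LIMIT») —
# INSTANTIATED AT THE ROAD'S PACKING WEIGHTS `colH K n μ y κ′` (the `ℋ`-column of a decaying packed resolvent `K`, `OneStepKernelFamily.colH`) AND A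
# FINE BI-STENCIL FAMILY `S₂` WITH THE `LocStencil₂` BODY, per slice `(κ′, κ″)` and for the finite SLICE SUM — the objects of (B3) PART 1
# `PackedDictionaryLetters.packed_second_letter`'s displayed socket `hWloc` and of (B6) `KCombineCovStrippedUniform`'s `hWM`∕`hlimWM`.

HONEST DEPENDENCY (cell records, verbatim): «continuum YM on T⁴ ⇐ BetaPertH ∧ nine spine estimates (0/9 proved); BetaPertH ⇐ (D1) ∧ (D4) ∧
CAP+tail; G-an2-4 gates asym, D1 and NE2/3/4.»  HONEST FRAMING (cell contract, verbatim): «discharging `BetaPertH` makes Bałaban's UV stability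
UNCONDITIONAL — a real constructive-QFT result; it is NOT the continuum limit and NOT the Clay problem.»  THIS MODULE DISCHARGES NOTHING of (K),
of D1 or of the wall: [folklore] instantiation BY NAME of `PeriodicArrayWrapLimit` ∕ `PeriodicArrayWrapUniform` (generic `D`, `F`) at `D := d+1`,
`F := Fib d`, weights `colH` (decay by `OneStepKernelFamily.abs_colH_le` + `OneStepResolventKernel.bound_mono`), plus finite-sum bookkeeping over the
`(d+1)²` slices.  No definition, no `def … : Prop`, nothing cited, 0 sorry.  0 root-level binders of row D1 discharged; (K) NOT closed; NOT D1, NOT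
`BetaPertH`, NOT continuum, NOT Clay.

ABSOLUTE RULE (cell charter, verbatim): «No internally-minted statement may enter as a cited fact. Every hypothesis is either kernel-proved in this
package or a verbatim quotation of a PUBLISHED theorem with page reference. The manuscript(s) under audit are NOT citable for their own disputed
steps — they are the thing under adjudication; programme-internal (2001/route/tribunal) claims are never citable.»

WHY (owner d1-p2 g17, (B3) PART 1 INTENT I-d1p2-g17-6; leaf-03 g21, (B6) `KCombineCovStrippedUniform`).  The road's p-dependent packed second table is
`𝒲^{(s)} := fun x z a b => Σ_{κ′} Σ_{κ″} wsum (colH K n μ y κ′) (u ↦ wsum (u″ ↦ Σ'_m colH K n ν y′ κ″ (u″ + s·m)) (S₂ κ′ u κ″)) x z a b` (nested-`wsum` spelling,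
definitionally the lambda spelling of `PeriodicArrayWrapLimit`), `s = n·p`; (B3) displays per slice `hWloc : BiLoc (wsum (colH …) (…)) (PW κ′ κ″) (QW κ′ κ″) CW δW`,
(B6) displays `hWM : ∀ k, BiLoc (𝒲^{(s_k)}) P Q C δ` and `hlimWM : 𝒲^{(s_k)} → 𝒲` entrywise.  THIS FILE gives those terms with NO rate juggling left to the
caller beyond `δ ≤ δK` (the stencil body's rate below the resolvent's; otherwise weaken the body first to `min δ δK` — the owner's
`PackedDictionaryLetters.body_mono`, (B3) PART 1).

CONTENT (all [folklore]; `K : MKer (d+1) (Fib d)` with `Decays K C δK`, `0 ≤ C`; `S₂` with `∀ κ u κ′ u′, BiLoc (S₂ κ u κ′ u′) u u (Ck·e^{−δ|u′−u|₁}) δ`, `0 < δ ≤ δK`).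
* §1 `colH_weight` (the `ℋ`-column decays from the centre `n·y` at every rate `m ≤ δK`).
* §2 per slice: **`biLoc_wsum_images_colH`** (`BiLoc (…periodised slice…) (n·y) (n·y) (C·(C·Ck·Zl(δ∕2)²)·Zl(δ∕2)) (δ∕2)`, every `s ≥ 1` — (B3)'s `hWloc` with
  `PW QW := n·y`), `biLoc_wsum_plain_colH` (the limit slice), **`abs_wsum_images_colH_sub_le`** (the explicit wrap tail), **`tendsto_wsum_images_colH`**.
* §3 slice sums: `biLoc_slices`, `tendsto_slices` (finite-sum bookkeeping), **`biLoc_sliceSum_images_colH`** ((B6)'s `hWM k` at `s := s_k`, constant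
  `(d+1)²·C·(C·Ck·Zl(δ∕2)²)·Zl(δ∕2)`), `biLoc_sliceSum_plain_colH`, **`tendsto_sliceSum_images_colH`** ((B6)'s `hlimWM`).
Provenance: G-an2-4 swarm leaf seat `b2b-balaban-gan24-formalise-leaf-05` (gen 50), cross-lane for road «BF-x», 2026-08-22.
-/

noncomputable section

namespace Summit.QuantumFields.BalabanUV.Beta.D1BFx.PeriodicArrayWrapColH

open Filter Topology
open scoped BigOperators
open Literature.MathematicalPhysics.QuantumFieldTheory.Balaban1983to89
open Literature.MathematicalPhysics.QuantumFieldTheory.Balaban1983to89.Beta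
open B12Sec2to5 (l1 l1_nonneg)
open ExpKernelCalculus (MKer BiLoc Decays Zl Zl_nonneg)
open OneStepResolventKernel (Fib wsum bound_mono)
open OneStepKernelFamily (colH abs_colH_le)
open Summit.QuantumFields.BalabanUV.Beta.D1BFx.PeriodicArrayWrapLimit (tendsto_wsum_images abs_wsum_images_sub_le)
open Summit.QuantumFields.BalabanUV.Beta.D1BFx.PeriodicArrayWrapUniform (biLoc_wsum_images biLoc_wsum_plain biLoc_pair_of_sep)

variable {d : ℕ}

/-! ## §1 The road's weights at any rate below the resolvent's -/

section Rates

variable {n : ℕ} {K : MKer (d + 1) (Fib d)} {C δK : ℝ}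
  {S₂ : Fin (d + 1) → (Fin (d + 1) → ℤ) → Fin (d + 1) → (Fin (d + 1) → ℤ) → MKer (d + 1) (Fib d)} {Ck δ : ℝ}

/-- [folklore] **THE `ℋ`-COLUMN WEIGHT DECAYS FROM THE COARSE BOND's CENTRE** at every rate `m ≤ δK`:
`|colH K n μ y κ′ u| ≤ C·e^{−m|u − n·y|₁}` (`abs_colH_le` + `bound_mono`; the `hw` shape of `PeriodicArrayWrapLimit`). -/
theorem colH_weight (hK : Decays K C δK) (hC : 0 ≤ C) {m : ℝ} (hm : m ≤ δK) (μ : Fin (d + 1)) (y : Fin (d + 1) → ℤ) (κ' : Fin (d + 1)) :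
    ∀ u, |colH K n μ y κ' u| ≤ C * Real.exp (-m * l1 (u - (n : ℤ) • y)) :=
  fun u => bound_mono (abs_colH_le (N := n) hK μ y κ' u) hC le_rfl hm (l1_nonneg _)

end Rates

/-! ## §2 Per slice: the WRAP sockets at the road's weights -/

section Slice

variable {n : ℕ} {K : MKer (d + 1) (Fib d)} {C δK : ℝ}
  {S₂ : Fin (d + 1) → (Fin (d + 1) → ℤ) → Fin (d + 1) → (Fin (d + 1) → ℤ) → MKer (d + 1) (Fib d)} {Ck δ : ℝ}

/-- [folklore] **«WRAP-UNIFORM» AT THE ROAD's WEIGHTS, PER SLICE** — (B3) PART 1's displayed `hWloc` with `PW QW := n·y`, `CW := C·(C·Ck·Zl(δ∕2)²)·Zl(δ∕2)`, `δW := δ∕2`: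
for a decaying packed resolvent `K` (`Decays K C δK`), a fine bi-stencil family with the `LocStencil₂` body at a rate `0 < δ ≤ δK`, every period `s ≥ 1`,
coarse bonds `(μ, y)`, `(ν, y′)` and slices `(κ′, κ″)`:
`BiLoc (wsum (colH K n μ y κ′) (u ↦ wsum (u″ ↦ Σ'_m colH K n ν y′ κ″ (u″ + s·m)) (S₂ κ′ u κ″))) (n·y) (n·y) CW (δ∕2)`. -/
theorem biLoc_wsum_images_colH (hK : Decays K C δK) (hC : 0 ≤ C)
    (hS₂ : ∀ κ u κ' u', BiLoc (S₂ κ u κ' u') u u (Ck * Real.exp (-δ * l1 (u' - u))) δ) (hδ : 0 < δ) (hδK : δ ≤ δK)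
    (s : ℕ) [NeZero s] (μ ν : Fin (d + 1)) (y y' : Fin (d + 1) → ℤ) (κ' κ'' : Fin (d + 1)) :
    BiLoc (wsum (colH K n μ y κ') (fun u => wsum (fun u'' => ∑' m : Fin (d + 1) → ℤ, colH K n ν y' κ'' (imageShift s u'' m)) (S₂ κ' u κ'')))
      ((n : ℤ) • y) ((n : ℤ) • y) (C * (C * Ck * Zl (d + 1) (δ / 2) * Zl (d + 1) (δ / 2)) * Zl (d + 1) (δ / 2)) (δ / 2) :=
  biLoc_wsum_images (K₂ := fun u u' => S₂ κ' u κ'' u') (colH_weight hK hC hδK μ y κ') (colH_weight hK hC hδK ν y' κ'')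
    (fun u u' => hS₂ κ' u κ'' u') hδ s

/-- [folklore] THE LIMIT SLICE is bi-localised at the same points: `BiLoc (wsum (colH K n μ y κ′) (u ↦ wsum (colH K n ν y′ κ″) (S₂ κ′ u κ″))) (n·y) (n·y)
(C·(C·Ck·Zl δ)·Zl(δ∕2)) (δ∕2)`. -/
theorem biLoc_wsum_plain_colH (hK : Decays K C δK) (hC : 0 ≤ C)
    (hS₂ : ∀ κ u κ' u', BiLoc (S₂ κ u κ' u') u u (Ck * Real.exp (-δ * l1 (u' - u))) δ) (hδ : 0 < δ) (hδK : δ ≤ δK)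
    (μ ν : Fin (d + 1)) (y y' : Fin (d + 1) → ℤ) (κ' κ'' : Fin (d + 1)) :
    BiLoc (wsum (colH K n μ y κ') (fun u => wsum (colH K n ν y' κ'') (S₂ κ' u κ'')))
      ((n : ℤ) • y) ((n : ℤ) • y) (C * (C * Ck * Zl (d + 1) δ) * Zl (d + 1) (δ / 2)) (δ / 2) :=
  biLoc_wsum_plain (K₂ := fun u u' => S₂ κ' u κ'' u') (colH_weight hK hC hδK μ y κ') (colH_weight hK hC hδK ν y' κ'')
    (fun u u' => hS₂ κ' u κ'' u') hδ

/-- [folklore] **THE WRAP-AROUND TAIL AT THE ROAD's WEIGHTS, PER SLICE**: for every `s ≥ 1` and every entry,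
`|periodised slice − plain slice| (x z a b) ≤ C·C·Ck·Zl δ·Zl(δ∕2)·e^{(δ∕2)|z − n·y′|₁}·imageTail (d+1) (δ∕2·s)`. -/
theorem abs_wsum_images_colH_sub_le (hK : Decays K C δK) (hC : 0 ≤ C)
    (hS₂ : ∀ κ u κ' u', BiLoc (S₂ κ u κ' u') u u (Ck * Real.exp (-δ * l1 (u' - u))) δ) (hδ : 0 < δ) (hδK : δ ≤ δK)
    (s : ℕ) [NeZero s] (μ ν : Fin (d + 1)) (y y' : Fin (d + 1) → ℤ) (κ' κ'' : Fin (d + 1)) (x z : Fin (d + 1) → ℤ) (a b : Fib d) :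
    |wsum (colH K n μ y κ') (fun u => wsum (fun u'' => ∑' m : Fin (d + 1) → ℤ, colH K n ν y' κ'' (imageShift s u'' m)) (S₂ κ' u κ'')) x z a b
        - wsum (colH K n μ y κ') (fun u => wsum (colH K n ν y' κ'') (S₂ κ' u κ'')) x z a b|
      ≤ C * C * Ck * Zl (d + 1) δ * Zl (d + 1) (δ / 2) * Real.exp (δ / 2 * l1 (z - (n : ℤ) • y')) * imageTail (d + 1) (δ / 2 * s) :=
  abs_wsum_images_sub_le (K₂ := fun u u' => S₂ κ' u κ'' u') (colH_weight hK hC hδK μ y κ') (colH_weight hK hC hδK ν y' κ'')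
    (fun u u' => biLoc_pair_of_sep (fun u u' => hS₂ κ' u κ'' u') hδ.le u u') hδ s x z a b

/-- [folklore] **«WRAP-LIMIT» AT THE ROAD's WEIGHTS, PER SLICE**: the periodised slice tends entrywise to the plain slice as `s → ∞`. -/
theorem tendsto_wsum_images_colH (hK : Decays K C δK) (hC : 0 ≤ C)
    (hS₂ : ∀ κ u κ' u', BiLoc (S₂ κ u κ' u') u u (Ck * Real.exp (-δ * l1 (u' - u))) δ) (hδ : 0 < δ) (hδK : δ ≤ δK)
    (μ ν : Fin (d + 1)) (y y' : Fin (d + 1) → ℤ) (κ' κ'' : Fin (d + 1)) (x z : Fin (d + 1) → ℤ) (a b : Fib d) :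
    Tendsto (fun s : ℕ => wsum (colH K n μ y κ')
        (fun u => wsum (fun u'' => ∑' m : Fin (d + 1) → ℤ, colH K n ν y' κ'' (imageShift s u'' m)) (S₂ κ' u κ'')) x z a b)
      atTop (𝓝 (wsum (colH K n μ y κ') (fun u => wsum (colH K n ν y' κ'') (S₂ κ' u κ'')) x z a b)) :=
  tendsto_wsum_images (K₂ := fun u u' => S₂ κ' u κ'' u') (colH_weight hK hC hδK μ y κ') (colH_weight hK hC hδK ν y' κ'')
    (fun u u' => biLoc_pair_of_sep (fun u u' => hS₂ κ' u κ'' u') hδ.le u u') hδ x z a b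

end Slice

/-! ## §3 The finite slice sum: (B6)'s `hWM` ∕ `hlimWM` -/

section SliceSum

/-- [folklore] A finite double sum of kernels bi-localised at common points is bi-localised, constant `(d+1)²·CW` (lambda spelling of the sum). -/
theorem biLoc_slices {G : Fin (d + 1) → Fin (d + 1) → MKer (d + 1) (Fib d)} {p q : Fin (d + 1) → ℤ} {CW δW : ℝ}
    (h : ∀ κ' κ'', BiLoc (G κ' κ'') p q CW δW) :
    BiLoc (fun x y a b => ∑ κ' : Fin (d + 1), ∑ κ'' : Fin (d + 1), G κ' κ'' x y a b) p q ((((d + 1 : ℕ) : ℝ)) ^ 2 * CW) δW := by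
  intro x y a b
  have hrow : ∀ κ' : Fin (d + 1), |∑ κ'' : Fin (d + 1), G κ' κ'' x y a b| ≤ ((d + 1 : ℕ) : ℝ) * (CW * Real.exp (-δW * (l1 (x - p) + l1 (y - q)))) := by
    intro κ'
    calc |∑ κ'' : Fin (d + 1), G κ' κ'' x y a b| ≤ ∑ κ'' : Fin (d + 1), |G κ' κ'' x y a b| := Finset.abs_sum_le_sum_abs _ _
      _ ≤ ∑ _κ'' : Fin (d + 1), CW * Real.exp (-δW * (l1 (x - p) + l1 (y - q))) := Finset.sum_le_sum fun κ'' _ => h κ' κ'' x y a b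
      _ = _ := by rw [Finset.sum_const, Finset.card_univ, Fintype.card_fin, nsmul_eq_mul]
  calc |∑ κ' : Fin (d + 1), ∑ κ'' : Fin (d + 1), G κ' κ'' x y a b| ≤ ∑ κ' : Fin (d + 1), |∑ κ'' : Fin (d + 1), G κ' κ'' x y a b| :=
        Finset.abs_sum_le_sum_abs _ _
    _ ≤ ∑ _κ' : Fin (d + 1), ((d + 1 : ℕ) : ℝ) * (CW * Real.exp (-δW * (l1 (x - p) + l1 (y - q)))) := Finset.sum_le_sum fun κ' _ => hrow κ'
    _ = (((d + 1 : ℕ) : ℝ)) ^ 2 * CW * Real.exp (-δW * (l1 (x - p) + l1 (y - q))) := by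
        rw [Finset.sum_const, Finset.card_univ, Fintype.card_fin, nsmul_eq_mul]; ring

/-- [folklore] A finite double sum of entrywise convergent sequences converges to the double sum of the limits. -/
theorem tendsto_slices {G : ℕ → Fin (d + 1) → Fin (d + 1) → ℝ} {Ginf : Fin (d + 1) → Fin (d + 1) → ℝ}
    (h : ∀ κ' κ'', Tendsto (fun s => G s κ' κ'') atTop (𝓝 (Ginf κ' κ''))) :
    Tendsto (fun s => ∑ κ' : Fin (d + 1), ∑ κ'' : Fin (d + 1), G s κ' κ'') atTop (𝓝 (∑ κ' : Fin (d + 1), ∑ κ'' : Fin (d + 1), Ginf κ' κ'')) :=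
  tendsto_finsetSum _ fun κ' _ => tendsto_finsetSum _ fun κ'' _ => h κ' κ''

variable {n : ℕ} {K : MKer (d + 1) (Fib d)} {C δK : ℝ}
  {S₂ : Fin (d + 1) → (Fin (d + 1) → ℤ) → Fin (d + 1) → (Fin (d + 1) → ℤ) → MKer (d + 1) (Fib d)} {Ck δ : ℝ}

/-- [folklore] **«WRAP-UNIFORM» FOR THE SLICE-SUMMED PACKED SECOND TABLE** ((B6)'s `hWM k` at `s := s_k`, `s`-free data): for every `s ≥ 1`,
`BiLoc (fun x z a b => Σ_{κ′} Σ_{κ″} wsum (colH K n μ y κ′) (u ↦ wsum (u″ ↦ Σ'_m colH K n ν y′ κ″ (u″ + s·m)) (S₂ κ′ u κ″)) x z a b) (n·y) (n·y)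
((d+1)²·C·(C·Ck·Zl(δ∕2)²)·Zl(δ∕2)) (δ∕2)`. -/
theorem biLoc_sliceSum_images_colH (hK : Decays K C δK) (hC : 0 ≤ C)
    (hS₂ : ∀ κ u κ' u', BiLoc (S₂ κ u κ' u') u u (Ck * Real.exp (-δ * l1 (u' - u))) δ) (hδ : 0 < δ) (hδK : δ ≤ δK)
    (s : ℕ) [NeZero s] (μ ν : Fin (d + 1)) (y y' : Fin (d + 1) → ℤ) :
    BiLoc (fun x z a b => ∑ κ' : Fin (d + 1), ∑ κ'' : Fin (d + 1),
        wsum (colH K n μ y κ') (fun u => wsum (fun u'' => ∑' m : Fin (d + 1) → ℤ, colH K n ν y' κ'' (imageShift s u'' m)) (S₂ κ' u κ'')) x z a b)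
      ((n : ℤ) • y) ((n : ℤ) • y) ((((d + 1 : ℕ) : ℝ)) ^ 2 * (C * (C * Ck * Zl (d + 1) (δ / 2) * Zl (d + 1) (δ / 2)) * Zl (d + 1) (δ / 2))) (δ / 2) :=
  biLoc_slices fun κ' κ'' => biLoc_wsum_images_colH hK hC hS₂ hδ hδK s μ ν y y' κ' κ''

/-- [folklore] … and for the slice-summed LIMIT table: `BiLoc (fun x z a b => Σ_{κ′} Σ_{κ″} wsum (colH K n μ y κ′) (u ↦ wsum (colH K n ν y′ κ″) (S₂ κ′ u κ″)) x z a b)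
(n·y) (n·y) ((d+1)²·C·(C·Ck·Zl δ)·Zl(δ∕2)) (δ∕2)`. -/
theorem biLoc_sliceSum_plain_colH (hK : Decays K C δK) (hC : 0 ≤ C)
    (hS₂ : ∀ κ u κ' u', BiLoc (S₂ κ u κ' u') u u (Ck * Real.exp (-δ * l1 (u' - u))) δ) (hδ : 0 < δ) (hδK : δ ≤ δK)
    (μ ν : Fin (d + 1)) (y y' : Fin (d + 1) → ℤ) :
    BiLoc (fun x z a b => ∑ κ' : Fin (d + 1), ∑ κ'' : Fin (d + 1),
        wsum (colH K n μ y κ') (fun u => wsum (colH K n ν y' κ'') (S₂ κ' u κ'')) x z a b)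
      ((n : ℤ) • y) ((n : ℤ) • y) ((((d + 1 : ℕ) : ℝ)) ^ 2 * (C * (C * Ck * Zl (d + 1) δ) * Zl (d + 1) (δ / 2))) (δ / 2) :=
  biLoc_slices fun κ' κ'' => biLoc_wsum_plain_colH hK hC hS₂ hδ hδK μ ν y y' κ' κ''

/-- [folklore] **«WRAP-LIMIT» FOR THE SLICE-SUMMED PACKED SECOND TABLE** ((B6)'s `hlimWM`): entrywise, as `s → ∞`,
`Σ_{κ′} Σ_{κ″} (periodised slices) x z a b → Σ_{κ′} Σ_{κ″} (plain slices) x z a b`. -/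
theorem tendsto_sliceSum_images_colH (hK : Decays K C δK) (hC : 0 ≤ C)
    (hS₂ : ∀ κ u κ' u', BiLoc (S₂ κ u κ' u') u u (Ck * Real.exp (-δ * l1 (u' - u))) δ) (hδ : 0 < δ) (hδK : δ ≤ δK)
    (μ ν : Fin (d + 1)) (y y' : Fin (d + 1) → ℤ) (x z : Fin (d + 1) → ℤ) (a b : Fib d) :
    Tendsto (fun s : ℕ => ∑ κ' : Fin (d + 1), ∑ κ'' : Fin (d + 1),
        wsum (colH K n μ y κ') (fun u => wsum (fun u'' => ∑' m : Fin (d + 1) → ℤ, colH K n ν y' κ'' (imageShift s u'' m)) (S₂ κ' u κ'')) x z a b)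
      atTop (𝓝 (∑ κ' : Fin (d + 1), ∑ κ'' : Fin (d + 1), wsum (colH K n μ y κ') (fun u => wsum (colH K n ν y' κ'') (S₂ κ' u κ'')) x z a b)) :=
  tendsto_slices (G := fun s κ' κ'' => wsum (colH K n μ y κ')
      (fun u => wsum (fun u'' => ∑' m : Fin (d + 1) → ℤ, colH K n ν y' κ'' (imageShift s u'' m)) (S₂ κ' u κ'')) x z a b)
    fun κ' κ'' => tendsto_wsum_images_colH hK hC hS₂ hδ hδK μ ν y y' κ' κ'' x z a b

end SliceSum

end Summit.QuantumFields.BalabanUV.Beta.D1BFx.PeriodicArrayWrapColH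

end
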